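import Summits.QuantumFields.QCD.Theses.OverlapPositivityTransfer
import Literature.MathematicalPhysics.QuantumLattice.OverlapDirac
import HarnessLib

/-!
# Route `OverlapPositivityTransfer` (QCD): the support item `GinspargWilsonPositivity` (stmt-QuantumFields-8819)

ABSTRACT GINSPARG–WILSON POSITIVITY (matrix form): for a Hermitian involution `Γ`, a unitary `V` that is `Γ`-hermitian
(`ΓVΓ = V†`) and reals `|b| < a`, `det(a·1 + b·V)` is real and strictly positive.  This is VERBATIM the tree's Literature
theorem `Literature.MathematicalPhysics.QuantumLattice.GinspargWilson.det_smul_one_add_smul_pos` ([Neuberger1998, eq. (10)];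
homotopy in `b`: the determinant is real, never vanishes since the spectrum of `V` is unimodular while `a/|b| > 1`, and equals
`aⁿ > 0` at `b = 0`); the item's hermiticity hypothesis on `Γ` is not needed.  Nothing is asserted about QCD; no summit, leg
or crux statement is proved (width seat ym-t4-w17 g0, free hands).
-/

set_option autoImplicit false

namespace Summit.QuantumFields.QCD.Theorems

/-- **Item stmt-QuantumFields-8819 `OverlapPositivityTransfer.GinspargWilsonPositivity` holds**, by the Literature theorem
`GinspargWilson.det_smul_one_add_smul_pos`. [cite: Neuberger1998, eq. (10)] -/
theorem overlapPositivityTransfer_ginspargWilsonPositivity_proof :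
    Summit.QuantumFields.QCD.Theses.OverlapPositivityTransfer.GinspargWilsonPositivity := by
  unfold Summit.QuantumFields.QCD.Theses.OverlapPositivityTransfer.GinspargWilsonPositivity
  intro n _ _ Γ V _ hΓ hVu hV a b hab
  exact Literature.MathematicalPhysics.QuantumLattice.GinspargWilson.det_smul_one_add_smul_pos Γ V hΓ hV hVu hab

end Summit.QuantumFields.QCD.Theorems
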